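import Summits.Parity.BatemanHorn.Theses.VanishingDimension

/-!
# Crux `TiltedLevel` (stmt-Parity-18603) — strategy census, Part C: typed signatures

Third strategist workfile (planner-cstrat-stmt-Parity-18603-r1-0, redirect strategist r1, 2026-08-17).
NOT route items, NOT a skeleton line: these are the Lean signatures referred to in
`STRATEGY-CENSUS.md`, Part C, checked to elaborate against the (built) route file
`Summits/Parity/BatemanHorn/Theses/VanishingDimension.lean`. `TiltedLevelInner` / `TiltedLevelAt` are
restated verbatim (as in Parts A/B) so that this file imports only the route file.

* §C Strengthen — THE WEAKEST USABLE FORM `TiltedLevelWeakAt` (K1_w): the crux's `=o[atTop]`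
  replaced by `IsBigOWith (η z)` with a constant `η(z) → 0` as `z → 0⁺`. `bigOWith_of_inner`,
  `weakAt_of_at` (PROVED): K1 ⇒ K1_w. The census explains why K1_w would still feed a (modified)
  dimension-zero sandwich and why it is closed for the same reason as K1 (the aggregate of the
  derived-prime strata over PRIME moduli exceeds the budget by λ = zk·log log x^θ → ∞, census (F1′)(ii)).
* §C Decomposition — D9, the BOUNDED-MODULI SHARE `BoundedModuliShare k f`: for each FIXED root class
  `(d, r)` the share `A(x;d,r)/A₁(x)` of the tilted mass tends to the model density `g(d,r)`; no
  rate, no level. `ShareOfTiltedLevel` records the (routine, unproved here) implication K1 ⇒ share law.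
  It is the only range of moduli where the strata aggregate stays bounded (λ_T = zk log log T), and it
  is still open for every shape other than `(k, deg) = (1, 1)` (census Part C, D9).
* §C.0 — THE BINDING INSTANCES, typed over existing declarations: `TwinSmallFactorSemiprimeLaw θ`
  (shifted primes `ℓ` with `ℓ + 2 = p·q`, `p < x^θ`; constant `2·C₂ = 𝔖({0,2})`,
  `Literature.NumberTheory.Sieve.twinPrimeConst`) and `LandauSmallFactorSemiprimeLaw θ` (`n² + 1 = p·q`,
  `p < x^θ`; constant `hardyLittlewoodEConst / 2`). These are the `(k, deg) = (2, 1)` and `(1, 2)` faces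
  of the derived-prime mean law that every known evaluation of a root-class total must deliver
  (census (F1)/(F1′)(ii), Part C §C.0). They are METHOD-LEVEL NECESSITIES, not logical consequences of
  the crux; both are OPEN (no lower bound of the right order is known for either count). Recorded as
  `Prop`s so that later seats (tribunal, tenure planner) can point at them by name.
-/

namespace Summit.Parity.BatemanHorn.Cruxes.TiltedLevel.CensusC

open scoped BigOperators Classical Topology
open Filter Asymptotics Finset Polynomial

/-! ## The crux body (verbatim) -/

/-- The crux body at one system `(k,f)`, one level `θ` and one tilt `z`: the `=o` relation of
`TiltedLevel` with every `let` copied verbatim. -/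
def TiltedLevelInner (k : ℕ) (f : Fin k → Polynomial ℤ) (θ z : ℝ) : Prop :=
  let w : ℕ → ℝ := fun n => z ^ (∑ i, ArithmeticFunction.cardDistinctFactors (((f i).eval (n : ℤ)).toNat)); let A : ℕ → ℕ → ℕ → ℝ := fun x d r => ∑ n ∈ (Finset.Icc 1 x).filter (fun n : ℕ => n ≡ r [MOD d]), w n; let cnt : ℕ → ℕ → ℕ := fun p s => (Finset.univ.filter (fun i => (p : ℤ) ∣ (f i).eval (s : ℤ))).card; let m : ℕ → ℝ := fun p => ∑ s ∈ Finset.range p, z ^ cnt p s; let g : ℕ → ℕ → ℝ := fun d r => ∏ p ∈ d.primeFactors, z ^ cnt p r / m p; let S : ℕ → ℕ → ℕ → ℝ := fun x d r => ∏ i, (1 - (∑ p ∈ d.primeFactors.filter (fun p : ℕ => (p : ℤ) ∣ (f i).eval (r : ℤ)), Real.log p) / (((f i).natDegree : ℝ) * Real.log x)) ^ (z - 1); let V : ℕ → ℝ := fun x => ∏ p ∈ (Finset.range ⌊(x : ℝ) ^ θ⌋₊).filter Nat.Prime, ((p : ℝ) - Literature.NumberTheory.Sieve.polyRootCountMod f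 p) / m p; (fun x : ℕ => ∑ d ∈ (Finset.Icc 1 ⌊(x : ℝ) ^ θ⌋₊).filter Squarefree, ∑ r ∈ (Finset.range d).filter (fun r : ℕ => (d : ℤ) ∣ ∏ i, (f i).eval (r : ℤ)), |A x d r - g d r * S x d r * ∑ n ∈ Finset.Icc 1 x, w n|) =o[atTop] fun x : ℕ => (∑ n ∈ Finset.Icc 1 x, w n) * V x

/-- The crux `TiltedLevel` with the system `(k, f)` fixed. -/
def TiltedLevelAt (k : ℕ) (f : Fin k → Polynomial ℤ) : Prop :=
  ∃ θ : ℝ, 0 < θ ∧ θ ≤ 1 / 4 ∧ ∃ z₀ : ℝ, 0 < z₀ ∧ ∀ z : ℝ, 0 < z → z < z₀ → TiltedLevelInner k f θ z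

/-- `TiltedLevel` is literally `∀ systems, TiltedLevelAt` (definitional). -/
theorem tiltedLevel_iff :
    Summit.Parity.BatemanHorn.Theses.VanishingDimension.TiltedLevel ↔
      ∀ (k : ℕ) (f : Fin k → Polynomial ℤ),
        Literature.NumberTheory.Sieve.IsBatemanHornSystem f → TiltedLevelAt k f := by
  rfl

/-! ## Strengthen, read downward: the weakest usable form K1_w -/

/-- The crux body with `=o[atTop]` replaced by `IsBigOWith c atTop` (an explicit eventual constant
`c` in front of `A₁V`); every `let` verbatim. -/
def TiltedLevelBigOWithInner (k : ℕ) (f : Fin k → Polynomial ℤ) (θ z c : ℝ) : Prop :=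
  let w : ℕ → ℝ := fun n => z ^ (∑ i, ArithmeticFunction.cardDistinctFactors (((f i).eval (n : ℤ)).toNat)); let A : ℕ → ℕ → ℕ → ℝ := fun x d r => ∑ n ∈ (Finset.Icc 1 x).filter (fun n : ℕ => n ≡ r [MOD d]), w n; let cnt : ℕ → ℕ → ℕ := fun p s => (Finset.univ.filter (fun i => (p : ℤ) ∣ (f i).eval (s : ℤ))).card; let m : ℕ → ℝ := fun p => ∑ s ∈ Finset.range p, z ^ cnt p s; let g : ℕ → ℕ → ℝ := fun d r => ∏ p ∈ d.primeFactors, z ^ cnt p r / m p; let S : ℕ → ℕ → ℕ → ℝ := fun x d r => ∏ i, (1 - (∑ p ∈ d.primeFactors.filter (fun p : ℕ => (p : ℤ) ∣ (f i).eval (r : ℤ)), Real.log p) / (((f i).natDegree : ℝ) * Real.log x)) ^ (z - 1); let V : ℕ → ℝ := fun x => ∏ p ∈ (Finset.range ⌊(x : ℝ) ^ θ⌋₊).filter Nat.Prime, ((p : ℝ) - Literature.NumberTheory.Sieve.polyRootCountMod f p) / m p; IsBigOWith c atTop (fun x : ℕ => ∑ d ∈ (Finset.Icc 1 ⌊(x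 : ℝ) ^ θ⌋₊).filter Squarefree, ∑ r ∈ (Finset.range d).filter (fun r : ℕ => (d : ℤ) ∣ ∏ i, (f i).eval (r : ℤ)), |A x d r - g d r * S x d r * ∑ n ∈ Finset.Icc 1 x, w n|) fun x : ℕ => (∑ n ∈ Finset.Icc 1 x, w n) * V x

/-- K1_w, THE WEAKEST USABLE FORM of the crux at one system: some level `θ ∈ (0, 1/4]`, a constant
`η(z) → 0` as `z → 0⁺`, and eventually (in `z`, then in `x`) the `ℓ¹` deviation is `≤ η(z)·A₁V`.
It still feeds a sandwich `|Σ_rough w − A₁V| ≤ (ε + C·η(z))·A₁V` (the sieve remainder enters the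
sandwich linearly), hence the same `closes` after letting `z → 0`; census Part C §Strengthen shows it
dissolves the single-class obstruction (F1) but not the prime-moduli aggregate (F1′)(ii). -/
def TiltedLevelWeakAt (k : ℕ) (f : Fin k → Polynomial ℤ) : Prop :=
  ∃ θ : ℝ, 0 < θ ∧ θ ≤ 1 / 4 ∧ ∃ η : ℝ → ℝ, Tendsto η (𝓝[>] 0) (𝓝 0) ∧
    ∃ z₀ : ℝ, 0 < z₀ ∧ ∀ z : ℝ, 0 < z → z < z₀ → TiltedLevelBigOWithInner k f θ z (η z)

/-- `o ⇒ O_c` for every `c > 0`, at equal `(θ, z)`. -/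
theorem bigOWith_of_inner (k : ℕ) (f : Fin k → Polynomial ℤ) (θ z c : ℝ) (hc : 0 < c)
    (h : TiltedLevelInner k f θ z) : TiltedLevelBigOWithInner k f θ z c := by
  dsimp only [TiltedLevelInner, TiltedLevelBigOWithInner] at h ⊢
  exact h.def' hc

/-- K1 ⇒ K1_w (with `η(z) = z`). -/
theorem weakAt_of_at (k : ℕ) (f : Fin k → Polynomial ℤ) (h : TiltedLevelAt k f) :
    TiltedLevelWeakAt k f := by
  obtain ⟨θ, hθ, hθ', z₀, hz₀, hz⟩ := h
  refine ⟨θ, hθ, hθ', id, ?_, z₀, hz₀, fun z hz1 hz2 => bigOWith_of_inner k f θ z z hz1 (hz z hz1 hz2)⟩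
  exact tendsto_nhdsWithin_of_tendsto_nhds tendsto_id

/-! ## Decomposition D9: the bounded-moduli share law -/

/-- D9 piece `BoundedModuliShare`: for every FIXED squarefree modulus `d` and root class `r`
(`d ∣ ∏ f_i(r)`), and all small `z`, the share `A(x;d,r)/A₁(x)` of the tilted mass tends to the model
density `g(d,r) = ∏_{p ∣ d} z^{cnt(p,r)}/m(p)` (the size factor `S → 1` at fixed `d`). No rate, no
level: the only range of moduli in which the derived-prime strata stay within budget
(`λ_T = zk·log log T` bounded). Still OPEN for every `(k, deg) ≠ (1,1)`: at small `z` both shares are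
carried by the prime cells of two different derived families (census Part C, D9). -/
def BoundedModuliShare (k : ℕ) (f : Fin k → Polynomial ℤ) : Prop :=
  ∃ z₀ : ℝ, 0 < z₀ ∧ ∀ z : ℝ, 0 < z → z < z₀ → ∀ d : ℕ, 0 < d → Squarefree d →
    ∀ r : ℕ, r < d → (d : ℤ) ∣ ∏ i, (f i).eval (r : ℤ) →
      let w : ℕ → ℝ := fun n => z ^ (∑ i, ArithmeticFunction.cardDistinctFactors (((f i).eval (n : ℤ)).toNat)); let A : ℕ → ℕ → ℕ → ℝ := fun x d r => ∑ n ∈ (Finset.Icc 1 x).filter (fun n : ℕ => n ≡ r [MOD d]), w n; let cnt : ℕ → ℕ → ℕ := fun p s => (Finset.univ.filter (fun i => (p : ℤ) ∣ (f i).eval (s : ℤ))).card; let m : ℕ → ℝ := fun p => ∑ s ∈ Finset.range p, z ^ cnt p s; let g : ℕ → ℕ → ℝ := fun d r => ∏ p ∈ d.primeFactors, z ^ cnt p r / m p; Tendsto (fun x : ℕ => A x d r / ∑ n ∈ Finset.Icc 1 x, w n) atTop (𝓝 (g d r))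

/-- The (routine, not proved in this census file) implication K1-at-a-system ⇒ D9: extract the
single term `(d, r)` from the `ℓ¹` sum once `d ≤ x^θ`, use `0 ≤ V ≤ 1` and `S(x;d,r) → 1`. -/
def ShareOfTiltedLevel : Prop :=
  ∀ (k : ℕ) (f : Fin k → Polynomial ℤ), Literature.NumberTheory.Sieve.IsBatemanHornSystem f →
    TiltedLevelAt k f → BoundedModuliShare k f

/-! ## §C.0 The binding instances (method-level necessities), typed -/

/-- `N_θ(x) = #{ℓ ≤ x : ℓ prime, ℓ + 2 = p·q with p < x^θ prime and q = (ℓ+2)/p prime}` —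
shifted primes that are semiprimes with a DESIGNATED small prime factor (the derived-prime stratum
of the twin system `(X, X+2)` at the prime moduli `p < x^θ`, census (F1′)(ii)). -/
noncomputable def twinSmallFactorCount (θ : ℝ) (x : ℕ) : ℕ :=
  ((Finset.Icc 1 x).filter (fun ℓ : ℕ => ℓ.Prime ∧
    ∃ p ∈ Finset.range ⌊(x : ℝ) ^ θ⌋₊, p.Prime ∧ p ∣ ℓ + 2 ∧ ((ℓ + 2) / p).Prime)).card

/-- OPEN (binding instance, `(k, deg) = (2, 1)`): the leading-order law
`N_θ(x)·(log x)²/(x·log log x) → 2C₂` (`0 < θ ≤ 1/4`; the leading term is `θ`-free: Hardy–Littlewood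
for the pairs `(q, pq − 2)` gives `𝔖_p = 2C₂(p−1)/(p−2)` and `Σ_{p<x^θ} 𝔖_p/(p·log(x/p)) ∼ 2C₂ log log x/log x`).
Status: upper bound of the right order by Selberg's sieve; NO lower bound of the right order (Chen:
`ℓ + 2 = P₂` for `≫ x/log²x` primes `ℓ`, neither the `log log x` nor the designated factorisation);
the asymptotic is a binary problem of twin-prime type for each `p`, inside Bombieri's parity
dichotomy (`Literature.NumberTheory.Sieve.bombieri_asymptotic_sieve`, `Literature.Barriers.Parity.FordFixedLevelBarrier`). -/
def TwinSmallFactorSemiprimeLaw (θ : ℝ) : Prop :=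
  Tendsto (fun x : ℕ => (twinSmallFactorCount θ x : ℝ) * Real.log x ^ 2 /
      ((x : ℝ) * Real.log (Real.log x))) atTop
    (𝓝 (2 * Literature.NumberTheory.Sieve.twinPrimeConst))

/-- `M_θ(x) = #{n ≤ x : n² + 1 = p·q with p < x^θ prime and q = (n²+1)/p prime}` — the derived-prime
stratum of the Landau system `(X² + 1)` at the prime moduli `p < x^θ`. -/
noncomputable def landauSmallFactorCount (θ : ℝ) (x : ℕ) : ℕ :=
  ((Finset.Icc 1 x).filter (fun n : ℕ =>
    ∃ p ∈ Finset.range ⌊(x : ℝ) ^ θ⌋₊, p.Prime ∧ p ∣ n ^ 2 + 1 ∧ ((n ^ 2 + 1) / p).Prime)).card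

/-- OPEN (binding instance, `(k, deg) = (1, 2)`): `M_θ(x)·log x/(x·log log x) → C(X²+1)/2`
(`Literature.NumberTheory.Sieve.hardyLittlewoodEConst / 2`; derived polynomials `((ν+pt)²+1)/p`, `t ≤ x/p`, of size
`x²/p`, local factors changed only at `p`; `Σ_{p<x^θ} ρ(p)/p ∼ log log x`). It asserts in particular
`P⁺(n²+1) ≥ x^{2−θ} ≥ x^{7/4}` for `≫ x log log x/log x` integers `n ≤ x`; the record is `P⁺(n²+1) > x^{1.279}`
infinitely often (Merikoski, JEMS 2023, arXiv:1908.08816, Thm 1), Type-II information for `n²+1` being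
available only for `P < x^{153/128}` (ibid. p. 4). -/
def LandauSmallFactorSemiprimeLaw (θ : ℝ) : Prop :=
  Tendsto (fun x : ℕ => (landauSmallFactorCount θ x : ℝ) * Real.log x /
      ((x : ℝ) * Real.log (Real.log x))) atTop
    (𝓝 (Literature.NumberTheory.Sieve.hardyLittlewoodEConst / 2))

end Summit.Parity.BatemanHorn.Cruxes.TiltedLevel.CensusC
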